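/-
Copyright: lead seat `ym-line-sll-p1` (prover-ym-line-sll-p1-g0-0), route `SoftLoopLongLag`, crux `ColdBoxSoftLoopLagFloor`
(stmt-QuantumFields-24180; stubs E1a `stub_innerFlatLagFloorG`, E1b `stub_innerDatumCovStabilityG` of `Cruxes/ColdBoxSoftLoopLagFloor/Lines/birth.lean` v7).
-/
import Summits.QuantumFields.YangMills.Theorems.SoftLoopLongLagLoopTranslation
import Summits.QuantumFields.YangMills.Theorems.SoftLoopLongLagDirichletLoopSurrogate

/-!
# The lag covariance of the translated soft-loop sum is `N⁻²` times the double sum of LOOP-COST covariances (route `SoftLoopLongLag`)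

WHAT.  For every probability measure `μ` on `ℤ⁴` configurations, every centre `c`, side `R` and lag `T`:
`lagCov μ (F_R ∘ θ_{−c}) T = (r.N)⁻² · Σ_{x,x' ∈ cube_R} Cov_μ(c_{x+c}, c_{x'+c+Te₀})` (`lagCov_softLoopObs_configShift_eq`), where
`c_y(U) = N − Re tr r(hol_U(rectWalk y 1 2 R R))` is the loop COST and `Cov_μ(f,g) = ∫fg − ∫f∫g`.  Steps: the translated (time-shifted) soft-loop sum
is `Σ_{x ∈ cube} W_{x+c(+Te₀)}` (ym-line-sll-p4's `softLoopObs_configShift_neg(_timeShiftLG)`), bilinearity of the connected two-point function over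
finite sums (`cov_sum_sum`, lead's `SoftLoopLongLagDirichletLoopSurrogate`), and `W_y = 1 − N⁻¹c_y` (`wilsonLoopObs_eq_one_sub_cost`, `cov_const_sub_smul`).

WHY.  The cores of the one-scale expansion (N2cov-loops / N2cov-flat interfaces of the E-architecture) are stated per PAIR of loop costs; this identity
is the bookkeeping that turns them into the stubs' `lagCov` of the cube-smeared observable (E1a: ym-line-sll-p2; E1b: lead).

HONEST LABEL.  Bookkeeping for a RECORD-label rung line (R2xi-G, leaf `WeakCouplingRates.XiPow` = an UPPER bound on the lattice mass gap, all compact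
simple `G`); NOT the Clay mass gap; no summit statement is touched.
-/

set_option autoImplicit false

noncomputable section

open MeasureTheory Finset
open Literature.Probability.LatticeModels (Site)
open Literature.MathematicalPhysics.QuantumLattice
open Literature.MathematicalPhysics.QuantumFieldTheory
open Summit.QuantumFields.YangMills.Theorems.WeakCouplingRates

namespace Summit.QuantumFields.YangMills.Theorems.SoftLoopLongLag

/-- Covariances scale: `Cov(A − t f, A − t g) = t²·Cov(f, g)` on a probability space (integrable `f, g, fg`). -/
theorem cov_const_sub_smul {Ω : Type*} [MeasurableSpace Ω] (μ : Measure Ω) [IsProbabilityMeasure μ] (A t : ℝ) {f g : Ω → ℝ}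
    (hf : Integrable f μ) (hg : Integrable g μ) (hfg : Integrable (fun ω => f ω * g ω) μ) :
    (∫ ω, (A - t * f ω) * (A - t * g ω) ∂μ) - (∫ ω, A - t * f ω ∂μ) * (∫ ω, A - t * g ω ∂μ) =
      t ^ 2 * ((∫ ω, f ω * g ω ∂μ) - (∫ ω, f ω ∂μ) * (∫ ω, g ω ∂μ)) := by
  have hsplit : ∀ ω, (A - t * f ω) * (A - t * g ω) = (A ^ 2 - (A * t) * f ω - (A * t) * g ω) + t ^ 2 * (f ω * g ω) := fun ω => by ring
  simp_rw [hsplit]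
  have i0 : Integrable (fun _ : Ω => A ^ 2) μ := integrable_const _
  have i1 : Integrable (fun ω => A ^ 2 - (A * t) * f ω) μ := i0.sub (hf.const_mul _)
  have i2 : Integrable (fun ω => A ^ 2 - (A * t) * f ω - (A * t) * g ω) μ := i1.sub (hg.const_mul _)
  have i3 : Integrable (fun ω => t ^ 2 * (f ω * g ω)) μ := hfg.const_mul _
  have iA : Integrable (fun _ : Ω => A) μ := integrable_const _
  have e1 : ∫ ω, (A ^ 2 - (A * t) * f ω - (A * t) * g ω) + t ^ 2 * (f ω * g ω) ∂μ =
      (A ^ 2 - (A * t) * ∫ ω, f ω ∂μ - (A * t) * ∫ ω, g ω ∂μ) + t ^ 2 * ∫ ω, f ω * g ω ∂μ := by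
    rw [integral_add i2 i3, integral_sub i1 (hg.const_mul _), integral_sub i0 (hf.const_mul _), integral_const, integral_const_mul,
      integral_const_mul, integral_const_mul, smul_eq_mul, probReal_univ, one_mul]
  have e2 : ∫ ω, A - t * f ω ∂μ = A - t * ∫ ω, f ω ∂μ := by
    rw [integral_sub iA (hf.const_mul _), integral_const, integral_const_mul, smul_eq_mul, probReal_univ, one_mul]
  have e3 : ∫ ω, A - t * g ω ∂μ = A - t * ∫ ω, g ω ∂μ := by
    rw [integral_sub iA (hg.const_mul _), integral_const, integral_const_mul, smul_eq_mul, probReal_univ, one_mul]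
  rw [e1, e2, e3]
  ring

variable {G : Type} [Group G] [TopologicalSpace G] [IsTopologicalGroup G] [CompactSpace G] [MeasurableSpace G] [BorelSpace G]

omit [IsTopologicalGroup G] [CompactSpace G] [MeasurableSpace G] [BorelSpace G] in
/-- **Loop observable vs loop cost**: `W_y(U) = 1 − N⁻¹·(N − Re tr r(hol))` for `N ≠ 0`. -/
theorem wilsonLoopObs_eq_one_sub_cost (r : LatticeRep G) (hN : (r.N : ℝ) ≠ 0) (y : Site 4) (R T : ℕ) (U : LGConfig 4 G) :
    wilsonLoopObs (fun g : G => (r.N : ℝ)⁻¹ * (r.ρ g).trace.re) (rectWalk y 1 2 R T) U =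
      1 - (r.N : ℝ)⁻¹ * ((r.N : ℝ) - (r.ρ (walkHolonomy U (rectWalk y 1 2 R T))).trace.re) := by
  simp only [wilsonLoopObs]
  rw [mul_sub, inv_mul_cancel₀ hN]
  ring

omit [MeasurableSpace G] [BorelSpace G] in
/-- The loop cost is bounded: `|c_y| ≤ 2N` (from `|W| ≤ 1`). -/
theorem abs_rectLoopCost_le_two_mul (r : LatticeRep G) (hN : 0 < r.N) (y : Site 4) (R T : ℕ) (U : LGConfig 4 G) :
    |(r.N : ℝ) - (r.ρ (walkHolonomy U (rectWalk y 1 2 R T))).trace.re| ≤ 2 * r.N := by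
  have hNpos : (0 : ℝ) < r.N := by exact_mod_cast hN
  have hNne : (r.N : ℝ) ≠ 0 := hNpos.ne'
  have hW := StringTension.abs_normalisedCharacter_le_one r.ρ r.continuous (walkHolonomy U (rectWalk y 1 2 R T))
  have heq : (r.N : ℝ) - (r.ρ (walkHolonomy U (rectWalk y 1 2 R T))).trace.re =
      r.N - r.N * ((r.N : ℝ)⁻¹ * (r.ρ (walkHolonomy U (rectWalk y 1 2 R T))).trace.re) := by
    rw [mul_inv_cancel_left₀ hNne]
  rw [heq]
  have h1 : |(r.N : ℝ)⁻¹ * (r.ρ (walkHolonomy U (rectWalk y 1 2 R T))).trace.re| ≤ 1 := hW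
  have h2 := abs_le.1 h1
  rw [abs_le]
  constructor <;> nlinarith [h2.1, h2.2]

/-- The loop cost is integrable under a finite measure (continuous and bounded). -/
theorem integrable_loopCost [SecondCountableTopology G] (r : LatticeRep G) (hN : 0 < r.N) (y : Site 4) (R T : ℕ)
    (μ : Measure (LGConfig 4 G)) [IsFiniteMeasure μ] :
    Integrable (fun U => (r.N : ℝ) - (r.ρ (walkHolonomy U (rectWalk y 1 2 R T))).trace.re) μ := by
  have hNne : (r.N : ℝ) ≠ 0 := by exact_mod_cast hN.ne'
  have hW := integrable_wilsonLoopObs_rectWalk r y R T μ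
  have heq : (fun U => (r.N : ℝ) - (r.ρ (walkHolonomy U (rectWalk y 1 2 R T))).trace.re) =
      fun U => (r.N : ℝ) - (r.N : ℝ) * wilsonLoopObs (fun g : G => (r.N : ℝ)⁻¹ * (r.ρ g).trace.re) (rectWalk y 1 2 R T) U := by
    funext U
    simp only [wilsonLoopObs]
    rw [mul_inv_cancel_left₀ hNne]
  rw [heq]
  exact (integrable_const _).sub (hW.const_mul _)

/-- Products of loop costs are integrable under a finite measure. -/
theorem integrable_loopCost_mul [SecondCountableTopology G] (r : LatticeRep G) (hN : 0 < r.N) (y y' : Site 4) (R T R' T' : ℕ)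
    (μ : Measure (LGConfig 4 G)) [IsFiniteMeasure μ] :
    Integrable (fun U => ((r.N : ℝ) - (r.ρ (walkHolonomy U (rectWalk y 1 2 R T))).trace.re) *
      ((r.N : ℝ) - (r.ρ (walkHolonomy U (rectWalk y' 1 2 R' T'))).trace.re)) μ :=
  (integrable_loopCost r hN y' R' T' μ).bdd_mul (integrable_loopCost r hN y R T μ).aestronglyMeasurable
    (ae_of_all _ fun U => by rw [Real.norm_eq_abs]; exact abs_rectLoopCost_le_two_mul r hN y R T U)

/-- **The lag covariance of the translated soft-loop sum as a double sum of loop-cost covariances**: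
`lagCov μ (F_R ∘ θ_{−c}) T = N⁻² · Σ_{x,x' ∈ cube_R} (∫ c_{x+c}·c_{x'+c+Te₀} dμ − ∫ c_{x+c} dμ · ∫ c_{x'+c+Te₀} dμ)`. -/
theorem lagCov_softLoopObs_configShift_eq [SecondCountableTopology G] (r : LatticeRep G) (hN : 0 < r.N) (R T : ℕ) (c : Site 4)
    (μ : Measure (LGConfig 4 G)) [IsProbabilityMeasure μ] :
    lagCov μ (fun U => softLoopObs r R (configShift (-c) U)) T =
      ((r.N : ℝ) ^ 2)⁻¹ * ∑ x ∈ timeZeroCube R, ∑ x' ∈ timeZeroCube R,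
        ((∫ U, ((r.N : ℝ) - (r.ρ (walkHolonomy U (rectWalk (x + c) 1 2 R R))).trace.re) *
            ((r.N : ℝ) - (r.ρ (walkHolonomy U (rectWalk (x' + c + Pi.single 0 (T : ℤ)) 1 2 R R))).trace.re) ∂μ) -
          (∫ U, ((r.N : ℝ) - (r.ρ (walkHolonomy U (rectWalk (x + c) 1 2 R R))).trace.re) ∂μ) *
            (∫ U, ((r.N : ℝ) - (r.ρ (walkHolonomy U (rectWalk (x' + c + Pi.single 0 (T : ℤ)) 1 2 R R))).trace.re) ∂μ)) := by
  have hNne : (r.N : ℝ) ≠ 0 := by exact_mod_cast hN.ne'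
  -- opaque names for the loop observable and the loop cost
  obtain ⟨W, hW⟩ : ∃ W : Site 4 → LGConfig 4 G → ℝ,
      ∀ y U, W y U = wilsonLoopObs (fun g : G => (r.N : ℝ)⁻¹ * (r.ρ g).trace.re) (rectWalk y 1 2 R R) U := ⟨_, fun _ _ => rfl⟩
  obtain ⟨K, hK⟩ : ∃ K : Site 4 → LGConfig 4 G → ℝ,
      ∀ y U, K y U = (r.N : ℝ) - (r.ρ (walkHolonomy U (rectWalk y 1 2 R R))).trace.re := ⟨_, fun _ _ => rfl⟩
  have hWK : ∀ y U, W y U = 1 - (r.N : ℝ)⁻¹ * K y U := fun y U => by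
    rw [hW, hK]; exact wilsonLoopObs_eq_one_sub_cost r hNne y R R U
  have hmem : ∀ y : Site 4, MemLp (W y) 2 μ := fun y => by
    have e : W y = fun U => wilsonLoopObs (fun g : G => (r.N : ℝ)⁻¹ * (r.ρ g).trace.re) (rectWalk y 1 2 R R) U := funext (hW y)
    rw [e]
    exact memLp_of_bounded (a := -1) (b := 1)
      (ae_of_all _ fun U => abs_le.1 (StringTension.abs_normalisedCharacter_le_one r.ρ r.continuous _))
      (continuous_wilsonLoopObs (continuous_normalisedCharacter_comp r.continuous) (rectWalk y 1 2 R R)).measurable.aestronglyMeasurable 2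
  have hKi : ∀ y, Integrable (K y) μ := fun y => by
    have e : K y = fun U => (r.N : ℝ) - (r.ρ (walkHolonomy U (rectWalk y 1 2 R R))).trace.re := funext (hK y)
    rw [e]; exact integrable_loopCost r hN y R R μ
  have hKKi : ∀ y y', Integrable (fun U => K y U * K y' U) μ := fun y y' => by
    have e : (fun U => K y U * K y' U) = fun U => ((r.N : ℝ) - (r.ρ (walkHolonomy U (rectWalk y 1 2 R R))).trace.re) *
        ((r.N : ℝ) - (r.ρ (walkHolonomy U (rectWalk y' 1 2 R R))).trace.re) := by funext U; rw [hK, hK]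
    rw [e]; exact integrable_loopCost_mul r hN y y' R R R R μ
  -- the two loop families (time `0` and time `T`), as opaque functions of the cube point
  obtain ⟨Wa, hWa⟩ : ∃ Wa : Site 4 → LGConfig 4 G → ℝ, ∀ x U, Wa x U = W (x + c) U := ⟨_, fun _ _ => rfl⟩
  obtain ⟨Wb, hWb⟩ : ∃ Wb : Site 4 → LGConfig 4 G → ℝ, ∀ x U, Wb x U = W (x + c + Pi.single 0 (T : ℤ)) U := ⟨_, fun _ _ => rfl⟩
  obtain ⟨Ka, hKa⟩ : ∃ Ka : Site 4 → LGConfig 4 G → ℝ, ∀ x U, Ka x U = K (x + c) U := ⟨_, fun _ _ => rfl⟩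
  obtain ⟨Kb, hKb⟩ : ∃ Kb : Site 4 → LGConfig 4 G → ℝ, ∀ x U, Kb x U = K (x + c + Pi.single 0 (T : ℤ)) U := ⟨_, fun _ _ => rfl⟩
  have hWKa : ∀ x, Wa x = fun U => 1 - (r.N : ℝ)⁻¹ * Ka x U := fun x => by funext U; rw [hWa, hKa, hWK]
  have hWKb : ∀ x, Wb x = fun U => 1 - (r.N : ℝ)⁻¹ * Kb x U := fun x => by funext U; rw [hWb, hKb, hWK]
  -- the translated sums, folded into `Wa`, `Wb`, `Ka`, `Kb`
  unfold lagCov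
  simp_rw [softLoopObs_configShift_neg_timeShiftLG, softLoopObs_configShift_neg]
  simp only [← hW, ← hK]
  simp only [← hWa, ← hWb, ← hKa, ← hKb]
  rw [cov_sum_sum μ (timeZeroCube R) (timeZeroCube R) Wa Wb (fun x _ => by rw [show Wa x = W (x + c) from funext (hWa x)]; exact hmem _)
    (fun x' _ => by rw [show Wb x' = W (x' + c + Pi.single 0 (T : ℤ)) from funext (hWb x')]; exact hmem _)]
  rw [Finset.mul_sum]
  refine Finset.sum_congr rfl fun x _ => ?_
  rw [Finset.mul_sum]
  refine Finset.sum_congr rfl fun x' _ => ?_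
  have hKai : Integrable (Ka x) μ := by rw [show Ka x = K (x + c) from funext (hKa x)]; exact hKi _
  have hKbi : Integrable (Kb x') μ := by rw [show Kb x' = K (x' + c + Pi.single 0 (T : ℤ)) from funext (hKb x')]; exact hKi _
  have hKKabi : Integrable (fun U => Ka x U * Kb x' U) μ := by
    have e : (fun U => Ka x U * Kb x' U) = fun U => K (x + c) U * K (x' + c + Pi.single 0 (T : ℤ)) U := by
      funext U; rw [hKa, hKb]
    rw [e]; exact hKKi _ _
  rw [hWKa x, hWKb x']
  simp only
  rw [cov_const_sub_smul μ 1 ((r.N : ℝ)⁻¹) hKai hKbi hKKabi, inv_pow]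

end Summit.QuantumFields.YangMills.Theorems.SoftLoopLongLag

end
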